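import Summits.Ventures.PercRepro.S1ParallelPairs
import Summits.Ventures.PercRepro.RankLevelSetTriangleStar

/-!
# PercRepro — THE FOUR-CIRCUIT COUNT AT BOUNDED NULLITY: `3·s₄ ≤ ν(ν + 1)(ν + 2)` under «lines ≤ 3, planes ≤ 6»
(p2, gen 14; SUBCLAIM-S1 Lemma T4)

`proofs/SUBCLAIM-S1-p2.md` §4, LEMMA T4. In a finite matroid whose rank-`≤ 2` sets have `≤ 3` points and whose
rank-`≤ 3` sets have `≤ 6` points, the number of `4`-element circuits is at most `ν(ν + 1)(ν + 2)/3`, `ν` the nullity.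
It replaces `RankLevelSetCircuitCount.ncard_circuits_le_choose` (`s₄ ≤ C(ν + 3, 4)`) in the counts of the `q = 4`
window, by the factor `8/(ν + 3)`.

PROOF. (i) For a non-loop `x` of a matroid `N` whose rank-`≤ 2` sets have `≤ 5` points, the triangles through `x`
inject (`C ↦ C ∖ {x}`) into the `2`-circuits of `N ／ {x}`, a matroid of the same nullity whose rank-`≤ 1` sets have
`≤ 4` points; so they number `≤ 2ν` (`S1ParallelPairs.ncard_two_circuits_le_two_mul`). (ii) Deleting a point on a
triangle (nullity `− 1`, the point bound kept): `s₃(N) ≤ Σ_{i ≤ ν} 2i = ν(ν + 1)`. (iii) For a non-loop `e` of `M`, the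
`4`-circuits through `e` inject into the triangles of `N := M ／ {e}`, whose rank-`≤ 2` sets have `≤ 5` points
(`r(L ∪ {e}) ≤ 3`); deleting `e` (on a `4`-circuit, so no coloop; nullity `− 1`) gives
`3·s₄(M) ≤ (ν − 1)ν(ν + 1) + 3ν(ν + 1) = ν(ν + 1)(ν + 2)`.

* `dual_eRank_eq_of_encard`, `encard_eq_of_dual_eRank` — the two forms of the nullity;
* **`ncard_trianglesThrough_le_two_mul`** — (i); **`ncard_triangles_le_mul_succ`** — (ii);
* **`three_mul_ncard_four_circuits_le`** — LEMMA T4, (iii).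
Axioms: standard.
-/

open scoped Matroid

namespace PercRepro

namespace S1

open Set

variable {α : Type}

/-- `|E| = r(E) + d` gives `ν = d` as the dual rank. -/
theorem dual_eRank_eq_of_encard (M : Matroid α) [M.Finite] {d : ℕ} (hd : M.E.encard = M.eRank + d) :
    M✶.eRank = (d : ℕ∞) := by
  have h := _root_.Matroid.eRank_add_eRank_dual M
  rw [hd] at h
  exact WithTop.add_left_cancel (PercRepro.Matroid.eRank_ne_top_of_finite M) h

/-- `ν = d` as the dual rank gives `|E| = r(E) + d`. -/
theorem encard_eq_of_dual_eRank (M : Matroid α) {d : ℕ} (h : M✶.eRank = (d : ℕ∞)) :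
    M.E.encard = M.eRank + d := by
  have h1 := _root_.Matroid.eRank_add_eRank_dual M
  rw [h] at h1
  exact h1.symm

/-- **Triangles through a point, lines with `≤ 5` points**: if every rank-`≤ 2` set has at most `5` points and
`|E| = r(E) + d`, at most `2d` triangles pass through a non-loop `x` — they inject into the `2`-circuits of `N ／ {x}`,
whose rank-`≤ 1` sets have `≤ 4` points. -/
theorem ncard_trianglesThrough_le_two_mul (N : Matroid α) [N.Finite]
    (h2 : ∀ L ⊆ N.E, N.eRk L ≤ 2 → L.ncard ≤ 5) {x : α} (hx : N.IsNonloop x) {d : ℕ}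
    (hd : N.E.encard = N.eRank + d) : (ThmN.trianglesThrough N x).ncard ≤ 2 * d := by
  classical
  have hxE : x ∈ N.E := hx.mem_ground
  have hxI : N.Indep {x} := hx.indep
  set K := N ／ {x} with hK
  have hKν : K✶.eRank = (d : ℕ∞) := by
    rw [hK, PercRepro.Matroid.dual_eRank_contract_singleton hxI]
    exact dual_eRank_eq_of_encard N hd
  have hKd : K.E.encard = K.eRank + d := encard_eq_of_dual_eRank K hKν
  have hKE : K.E = N.E \ {x} := _root_.Matroid.contract_ground N {x}
  -- rank-`≤ 1` sets of `K` have `≤ 4` points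
  have h1 : ∀ L ⊆ K.E, K.eRk L ≤ 1 → L.ncard ≤ 4 := by
    intro L hL hr
    rw [hKE] at hL
    have hxL : x ∉ L := fun h => (hL h).2 rfl
    have hLfin : L.Finite := N.ground_finite.subset (hL.trans sdiff_subset)
    have hins : N.eRk (insert x L) ≤ 2 := by
      have h := contract_singleton_eRk_add_one hxI hL
      rw [← hK] at h
      rw [← h]
      calc K.eRk L + 1 ≤ 1 + 1 := add_le_add_left hr 1
        _ = 2 := by norm_num
    have h5 := h2 (insert x L) (insert_subset hxE (hL.trans sdiff_subset)) hins
    rw [ncard_insert_of_notMem hxL hLfin] at h5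
    omega
  -- the injection `C ↦ C ∖ {x}` into the `2`-circuits of `K`
  let f : Set α → Set α := fun C => C \ {x}
  have hmaps : ∀ C ∈ ThmN.trianglesThrough N x, f C ∈ {C' : Set α | K.IsCircuit C' ∧ C'.ncard = 2} := by
    intro C hC
    have hCfin : C.Finite := N.ground_finite.subset hC.1.subset_ground
    refine ⟨hC.1.contractElem_isCircuit ?_ hC.2.2, ?_⟩
    · have h1lt : 1 < C.ncard := by rw [hC.2.1]; omega
      obtain ⟨a, ha, b, hb, hab⟩ := (one_lt_ncard hCfin).1 h1lt
      exact ⟨a, ha, b, hb, hab⟩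
    · have h3 := ncard_sdiff_singleton_add_one hC.2.2 hCfin
      have h4 := hC.2.1
      simp only [f]
      omega
  have hinj : InjOn f (ThmN.trianglesThrough N x) := by
    intro C hC C' hC' h
    have e1 : C = insert x (C \ {x}) := by rw [insert_sdiff_singleton, insert_eq_of_mem hC.2.2]
    have e2 : C' = insert x (C' \ {x}) := by rw [insert_sdiff_singleton, insert_eq_of_mem hC'.2.2]
    rw [e1, e2]
    simp only [f] at h
    rw [h]
  calc (ThmN.trianglesThrough N x).ncard ≤ {C' : Set α | K.IsCircuit C' ∧ C'.ncard = 2}.ncard :=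
        ncard_le_ncard_of_injOn f hmaps hinj
          (K.ground_finite.finite_subsets.subset (fun C hC => hC.1.subset_ground))
    _ ≤ 2 * d := ncard_two_circuits_le_two_mul K h1 hKd

/-- **The triangle count with lines of `≤ 5` points**: `#(triangles N) ≤ d(d + 1)` when `|E| = r(E) + d` and every
rank-`≤ 2` set has at most `5` points (the deletion induction of Lemma T with `2d` triangles through a point). -/
theorem ncard_triangles_le_mul_succ (N : Matroid α) [N.Finite]
    (h2 : ∀ L ⊆ N.E, N.eRk L ≤ 2 → L.ncard ≤ 5) {d : ℕ} (hd : N.E.encard = N.eRank + d) :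
    (ThmN.triangles N).ncard ≤ d * (d + 1) := by
  suffices H : ∀ n : ℕ, ∀ (N : Matroid α) [N.Finite], N.E.ncard = n →
      (∀ L ⊆ N.E, N.eRk L ≤ 2 → L.ncard ≤ 5) → ∀ d : ℕ, N.E.encard = N.eRank + d →
      (ThmN.triangles N).ncard ≤ d * (d + 1) from H _ N rfl h2 d hd
  intro n
  induction n using Nat.strong_induction_on with
  | _ n ih =>
  intro N _ hn h2 d hd
  classical
  set S := ThmN.triangles N with hS
  have hSfin : S.Finite :=
    N.ground_finite.finite_subsets.subset (fun C hC => hC.1.subset_ground)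
  by_cases hSe : S = ∅
  · rw [hSe, ncard_empty]; exact Nat.zero_le _
  obtain ⟨C₀, hC₀⟩ := nonempty_iff_ne_empty.2 hSe
  obtain ⟨e, heC₀⟩ := hC₀.1.nonempty
  have heE : e ∈ N.E := hC₀.1.subset_ground heC₀
  have hne : ¬ N.IsColoop e := hC₀.1.not_isColoop_of_mem heC₀
  have hν : N✶.eRank = (d : ℕ∞) := dual_eRank_eq_of_encard N hd
  have hdel := PercRepro.Matroid.dual_eRank_delete_singleton_add_one heE hne
  rw [hν] at hdel
  have hfin' : (N ＼ {e})✶.eRank ≠ ⊤ := by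
    intro h
    rw [h] at hdel
    exact absurd hdel (by simp)
  obtain ⟨d', hd'⟩ := ENat.ne_top_iff_exists.1 hfin'
  have hdd' : d = d' + 1 := by
    rw [← hd'] at hdel
    exact_mod_cast hdel.symm
  have hd'enc : (N ＼ {e}).E.encard = (N ＼ {e}).eRank + d' := encard_eq_of_dual_eRank _ hd'.symm
  have hdelE : (N ＼ {e}).E.ncard < n := by
    rw [_root_.Matroid.delete_ground, ← hn, ← ncard_sdiff_singleton_add_one heE N.ground_finite]
    omega
  have h2' : ∀ L ⊆ (N ＼ {e}).E, (N ＼ {e}).eRk L ≤ 2 → L.ncard ≤ 5 := by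
    intro L hL hr
    rw [_root_.Matroid.delete_ground] at hL
    rw [delete_singleton_eRk_eq hL] at hr
    exact h2 L (hL.trans sdiff_subset) hr
  set S₁ := ThmN.trianglesThrough N e with hS₁
  set S₂ := {C | N.IsCircuit C ∧ C.ncard = 3 ∧ e ∉ C} with hS₂
  have hsplit : S ⊆ S₁ ∪ S₂ := by
    intro C hC
    by_cases h : e ∈ C
    · exact Or.inl ⟨hC.1, hC.2, h⟩
    · exact Or.inr ⟨hC.1, hC.2, h⟩
  have hS₁fin : S₁.Finite := hSfin.subset (fun C hC => ⟨hC.1, hC.2.1⟩)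
  have hS₂fin : S₂.Finite := hSfin.subset (fun C hC => ⟨hC.1, hC.2.1⟩)
  have hx : N.IsNonloop e := by
    refine _root_.Matroid.isNonloop_of_not_isLoop heE ?_
    intro hloop
    have hC₀e : C₀ = {e} := hloop.eq_of_isCircuit_mem hC₀.1 heC₀
    have := hC₀.2
    rw [hC₀e, ncard_singleton] at this
    omega
  have h1 : S₁.ncard ≤ 2 * d := ncard_trianglesThrough_le_two_mul N h2 hx hd
  have hsub : S₂ ⊆ ThmN.triangles (N ＼ {e}) := by
    intro C hC
    exact ⟨_root_.Matroid.delete_isCircuit_iff.2 ⟨hC.1, disjoint_singleton_right.2 hC.2.2⟩, hC.2.1⟩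
  have h2c : S₂.ncard ≤ d' * (d' + 1) :=
    calc S₂.ncard ≤ (ThmN.triangles (N ＼ {e})).ncard :=
          ncard_le_ncard hsub
            ((N ＼ {e}).ground_finite.finite_subsets.subset (fun C hC => hC.1.subset_ground))
      _ ≤ d' * (d' + 1) := ih _ hdelE (N ＼ {e}) rfl h2' d' hd'enc
  have h3 : S.ncard ≤ S₁.ncard + S₂.ncard :=
    (ncard_le_ncard hsplit (hS₁fin.union hS₂fin)).trans (ncard_union_le _ _)
  subst hdd'
  nlinarith [h1, h2c, h3]

/-- **LEMMA T4 — the four-circuit count at bounded nullity.** If `|E| = r(E) + d`, every rank-`≤ 2` set has at most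
`3` points and every rank-`≤ 3` set has at most `6` points, then `3·#(4-circuits) ≤ d(d + 1)(d + 2)`: the `4`-circuits
through a point `e` inject into the triangles of `M ／ {e}` (whose rank-`≤ 2` sets have `≤ 5` points), and the
others are the `4`-circuits of `M ＼ {e}`. -/
theorem three_mul_ncard_four_circuits_le (M : Matroid α) [M.Finite]
    (hC1 : ∀ L ⊆ M.E, M.eRk L ≤ 2 → L.ncard ≤ 3) (hC2 : ∀ P ⊆ M.E, M.eRk P ≤ 3 → P.ncard ≤ 6) {d : ℕ}
    (hd : M.E.encard = M.eRank + d) :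
    3 * {C : Set α | M.IsCircuit C ∧ C.ncard = 4}.ncard ≤ d * (d + 1) * (d + 2) := by
  suffices H : ∀ n : ℕ, ∀ (M : Matroid α) [M.Finite], M.E.ncard = n →
      (∀ L ⊆ M.E, M.eRk L ≤ 2 → L.ncard ≤ 3) → (∀ P ⊆ M.E, M.eRk P ≤ 3 → P.ncard ≤ 6) →
      ∀ d : ℕ, M.E.encard = M.eRank + d →
      3 * {C : Set α | M.IsCircuit C ∧ C.ncard = 4}.ncard ≤ d * (d + 1) * (d + 2) from
    H _ M rfl hC1 hC2 d hd
  intro n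
  induction n using Nat.strong_induction_on with
  | _ n ih =>
  intro M _ hn hC1 hC2 d hd
  classical
  set S := {C : Set α | M.IsCircuit C ∧ C.ncard = 4} with hS
  have hSfin : S.Finite :=
    M.ground_finite.finite_subsets.subset (fun C hC => hC.1.subset_ground)
  by_cases hSe : S = ∅
  · rw [hSe, ncard_empty]; exact Nat.zero_le _
  obtain ⟨C₀, hC₀⟩ := nonempty_iff_ne_empty.2 hSe
  obtain ⟨e, heC₀⟩ := hC₀.1.nonempty
  have heE : e ∈ M.E := hC₀.1.subset_ground heC₀
  have hne : ¬ M.IsColoop e := hC₀.1.not_isColoop_of_mem heC₀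
  have hν : M✶.eRank = (d : ℕ∞) := dual_eRank_eq_of_encard M hd
  have hdel := PercRepro.Matroid.dual_eRank_delete_singleton_add_one heE hne
  rw [hν] at hdel
  have hfin' : (M ＼ {e})✶.eRank ≠ ⊤ := by
    intro h
    rw [h] at hdel
    exact absurd hdel (by simp)
  obtain ⟨d', hd'⟩ := ENat.ne_top_iff_exists.1 hfin'
  have hdd' : d = d' + 1 := by
    rw [← hd'] at hdel
    exact_mod_cast hdel.symm
  have hd'enc : (M ＼ {e}).E.encard = (M ＼ {e}).eRank + d' := encard_eq_of_dual_eRank _ hd'.symm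
  have hdelE : (M ＼ {e}).E.ncard < n := by
    rw [_root_.Matroid.delete_ground, ← hn, ← ncard_sdiff_singleton_add_one heE M.ground_finite]
    omega
  have hC1' : ∀ L ⊆ (M ＼ {e}).E, (M ＼ {e}).eRk L ≤ 2 → L.ncard ≤ 3 := by
    intro L hL hr
    rw [_root_.Matroid.delete_ground] at hL
    rw [delete_singleton_eRk_eq hL] at hr
    exact hC1 L (hL.trans sdiff_subset) hr
  have hC2' : ∀ P ⊆ (M ＼ {e}).E, (M ＼ {e}).eRk P ≤ 3 → P.ncard ≤ 6 := by
    intro P hP hr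
    rw [_root_.Matroid.delete_ground] at hP
    rw [delete_singleton_eRk_eq hP] at hr
    exact hC2 P (hP.trans sdiff_subset) hr
  -- `e` is not a loop
  have heI : M.Indep {e} := by
    rw [_root_.Matroid.indep_singleton, ← _root_.Matroid.not_isLoop_iff heE]
    intro hloop
    have hC₀e : C₀ = {e} := hloop.eq_of_isCircuit_mem hC₀.1 heC₀
    have := hC₀.2
    rw [hC₀e, ncard_singleton] at this
    omega
  -- the contraction `N = M ／ {e}`: nullity `d`, rank-`≤ 2` sets with `≤ 5` points
  set N := M ／ {e} with hN
  have hNd : N.E.encard = N.eRank + d := by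
    apply encard_eq_of_dual_eRank
    rw [hN, PercRepro.Matroid.dual_eRank_contract_singleton heI, hν]
  have hNE : N.E = M.E \ {e} := _root_.Matroid.contract_ground M {e}
  have h2N : ∀ L ⊆ N.E, N.eRk L ≤ 2 → L.ncard ≤ 5 := by
    intro L hL hr
    rw [hNE] at hL
    have heL : e ∉ L := fun h => (hL h).2 rfl
    have hLfin : L.Finite := M.ground_finite.subset (hL.trans sdiff_subset)
    have hins : M.eRk (insert e L) ≤ 3 := by
      have h := contract_singleton_eRk_add_one heI hL
      rw [← hN] at h
      rw [← h]
      calc N.eRk L + 1 ≤ 2 + 1 := add_le_add_left hr 1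
        _ = 3 := by norm_num
    have h6 := hC2 (insert e L) (insert_subset heE (hL.trans sdiff_subset)) hins
    rw [ncard_insert_of_notMem heL hLfin] at h6
    omega
  -- split by `e`
  set S₁ := {C : Set α | M.IsCircuit C ∧ C.ncard = 4 ∧ e ∈ C} with hS₁
  set S₂ := {C : Set α | M.IsCircuit C ∧ C.ncard = 4 ∧ e ∉ C} with hS₂
  have hsplit : S ⊆ S₁ ∪ S₂ := by
    intro C hC
    by_cases h : e ∈ C
    · exact Or.inl ⟨hC.1, hC.2, h⟩
    · exact Or.inr ⟨hC.1, hC.2, h⟩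
  have hS₁fin : S₁.Finite := hSfin.subset (fun C hC => ⟨hC.1, hC.2.1⟩)
  have hS₂fin : S₂.Finite := hSfin.subset (fun C hC => ⟨hC.1, hC.2.1⟩)
  -- the `4`-circuits through `e` inject into the triangles of `N`
  have h1 : S₁.ncard ≤ d * (d + 1) := by
    let f : Set α → Set α := fun C => C \ {e}
    have hmaps : ∀ C ∈ S₁, f C ∈ ThmN.triangles N := by
      intro C hC
      have hCfin : C.Finite := M.ground_finite.subset hC.1.subset_ground
      refine ⟨hC.1.contractElem_isCircuit ?_ hC.2.2, ?_⟩
      · have h1lt : 1 < C.ncard := by rw [hC.2.1]; omega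
        obtain ⟨a, ha, b, hb, hab⟩ := (one_lt_ncard hCfin).1 h1lt
        exact ⟨a, ha, b, hb, hab⟩
      · have h3 := ncard_sdiff_singleton_add_one hC.2.2 hCfin
        have h4 := hC.2.1
        simp only [f]
        omega
    have hinj : InjOn f S₁ := by
      intro C hC C' hC' h
      have e1 : C = insert e (C \ {e}) := by rw [insert_sdiff_singleton, insert_eq_of_mem hC.2.2]
      have e2 : C' = insert e (C' \ {e}) := by rw [insert_sdiff_singleton, insert_eq_of_mem hC'.2.2]
      rw [e1, e2]
      simp only [f] at h
      rw [h]
    calc S₁.ncard ≤ (ThmN.triangles N).ncard :=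
          ncard_le_ncard_of_injOn f hmaps hinj
            (N.ground_finite.finite_subsets.subset (fun C hC => hC.1.subset_ground))
      _ ≤ d * (d + 1) := ncard_triangles_le_mul_succ N h2N hNd
  -- the `4`-circuits avoiding `e` are those of `M ＼ {e}`
  have h2c : 3 * S₂.ncard ≤ d' * (d' + 1) * (d' + 2) := by
    have hsub : S₂ ⊆ {C : Set α | (M ＼ {e}).IsCircuit C ∧ C.ncard = 4} := by
      intro C hC
      exact ⟨_root_.Matroid.delete_isCircuit_iff.2 ⟨hC.1, disjoint_singleton_right.2 hC.2.2⟩, hC.2.1⟩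
    calc 3 * S₂.ncard ≤ 3 * {C : Set α | (M ＼ {e}).IsCircuit C ∧ C.ncard = 4}.ncard := by
          apply Nat.mul_le_mul_left
          exact ncard_le_ncard hsub
            ((M ＼ {e}).ground_finite.finite_subsets.subset (fun C hC => hC.1.subset_ground))
      _ ≤ d' * (d' + 1) * (d' + 2) := ih _ hdelE (M ＼ {e}) rfl hC1' hC2' d' hd'enc
  have h3 : S.ncard ≤ S₁.ncard + S₂.ncard :=
    (ncard_le_ncard hsplit (hS₁fin.union hS₂fin)).trans (ncard_union_le _ _)
  subst hdd'
  nlinarith [h1, h2c, h3]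

end S1

end PercRepro
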